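import Literature.NumberTheory.Sieve.LargeGapsRateComparison
import HarnessLib

/-!
# Large gaps between primes: FGKT 2016 Theorem 1 ⟺ "Rankin's bound with an arbitrarily large
# constant", and the `ε`-free normal form of the Rankin-constant family

Topic `Literature/NumberTheory/Sieve`. Everything in this file is PROVED.

Ford–Green–Konyagin–Tao state their main theorem as a run of composites (Theorem 1: "at least
`R log X log₂ X log₄ X/(log₃ X)²` consecutive composite natural numbers not exceeding `X`", every
`R`) and describe it as "the constant `c` in Rankin's bound may be taken arbitrarily large"
[FordGreenKonyaginTao2016, p. 936]; Maynard states the same result as a `limsup`. The ladder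
`LargeGapsBetweenPrimes.lean` types Rankin-type bounds as `RankinConstant c`
(`G(X) ≥ (c − ε) R(X)` for all large `X`, every `ε > 0`). Here:

* `forall_rankinConstant_iff`: `(∀ c, RankinConstant c) ↔ ∀ c, ∀ᶠ X, G(X) ≥ c R(X)` (the `ε`
  disappears once every constant is available);
* `fgkt2016_theorem1_of_rankinConstant` and, with `rankinConstant_of_fgkt2016_theorem1`
  (`LargeGapsRateComparison.lean`), the equivalence `fgkt2016_theorem1_iff_rankinConstant`:
  **FGKT 2016 Theorem 1 ⟺ ∀ c, RankinConstant c**;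
* `fgkt2016_theorem1_of_fgkmt2018_theorem1`: the 2018 record implies the 2016 theorem.

## References

* K. Ford, B. Green, S. Konyagin, T. Tao, *Large gaps between consecutive prime numbers*, Ann. of
  Math. 183 (2016) 935–974, Theorem 1 and p. 936. [FordGreenKonyaginTao2016]
* K. Ford, B. Green, S. Konyagin, J. Maynard, T. Tao, *Long gaps between primes*, J. Amer. Math.
  Soc. 31 (2018) 65–105, Theorem 1 and (1.1). [FordGreenKonyaginMaynardTao2018]
-/

open Filter Finset

namespace Literature.NumberTheory.Sieve

/-- **Normal form of "every Rankin constant"**: `(∀ c, G(X) ≥ (c − ε) R(X) eventually, ∀ ε > 0)`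
iff `(∀ c, G(X) ≥ c R(X) eventually)`. [cite: FordGreenKonyaginTao2016, p. 936 ("the constant may
be taken arbitrarily large")] -/
theorem forall_rankinConstant_iff :
    (∀ c : ℝ, RankinConstant c) ↔ ∀ c : ℝ, ∀ᶠ X : ℝ in atTop, HasPrimeGap X (c * rankinRate X) := by
  constructor
  · intro h c
    filter_upwards [h (c + 1) 1 one_pos] with X hX
    have e : c + 1 - 1 = c := by ring
    rwa [e] at hX
  · intro h c ε hε
    filter_upwards [h c, tendsto_rankinRate_atTop.eventually_ge_atTop 0] with X hX hr0
    exact hX.mono le_rfl (mul_le_mul_of_nonneg_right (by linarith) hr0)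

/-- **(every Rankin constant) ⇒ FGKT 2016 Theorem 1**: a prime gap `≥ (R⁺ + 2) R(X)` below `X` is
a run of `⌈(R⁺+2) R(X)⌉ − 1 ≥ R · R(X)` consecutive composites below `X` (`R(X) ≥ 1` for large
`X`). PROVED. [cite: FordGreenKonyaginTao2016, Theorem 1 and Lemma 1.1] -/
theorem fgkt2016_theorem1_of_rankinConstant (h : ∀ c : ℝ, RankinConstant c) :
    FordGreenKonyaginTao2016_theorem1 := by
  intro R
  filter_upwards [h (max R 0 + 3) 1 one_pos, eventually_log_le_rankinRate,
    Real.tendsto_log_atTop.eventually_ge_atTop 1] with X hX hlr hlog1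
  refine ⟨⌈(max R 0 + 3 - 1) * rankinRate X⌉₊ - 1, ?_, hasCompositeRun_of_hasPrimeGap hX⟩
  have hrr : 1 ≤ rankinRate X := hlog1.trans hlr
  have hR0 : 0 ≤ max R 0 := le_max_right _ _
  have hv2 : 2 ≤ (max R 0 + 3 - 1) * rankinRate X := by nlinarith
  have hceil1 : 1 ≤ ⌈(max R 0 + 3 - 1) * rankinRate X⌉₊ := Nat.one_le_ceil_iff.2 (by linarith)
  rw [Nat.cast_sub hceil1, Nat.cast_one]
  have hceil := Nat.le_ceil ((max R 0 + 3 - 1) * rankinRate X)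
  calc R * rankinRate X ≤ max R 0 * rankinRate X :=
        mul_le_mul_of_nonneg_right (le_max_left _ _) (by linarith)
    _ = (max R 0 + 3 - 1) * rankinRate X - 2 * rankinRate X := by ring
    _ ≤ (⌈(max R 0 + 3 - 1) * rankinRate X⌉₊ : ℝ) - 1 := by linarith

/-- **FGKT 2016 Theorem 1 ⟺ every Rankin constant** ("Rankin's bound with `c` arbitrarily
large"). PROVED (`→`: the doubling bound for `R`, `LargeGapsRateComparison.lean`; `←`: above).
[cite: FordGreenKonyaginTao2016, Theorem 1 and p. 936] -/
theorem fgkt2016_theorem1_iff_rankinConstant :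
    FordGreenKonyaginTao2016_theorem1 ↔ ∀ c : ℝ, RankinConstant c :=
  ⟨rankinConstant_of_fgkt2016_theorem1, fgkt2016_theorem1_of_rankinConstant⟩

/-- **FGKMT 2018 Theorem 1 ⇒ FGKT 2016 Theorem 1** (the record rate `log X log₂ X log₄ X/log₃ X`
dominates Rankin's by the factor `log₃ X → ∞`: "Theorem 1 implies (1.1) with any constant").
PROVED. [cite: FordGreenKonyaginMaynardTao2018, Theorem 1 and (1.1)] -/
theorem fgkt2016_theorem1_of_fgkmt2018_theorem1 (h : FordGreenKonyaginMaynardTao2018_theorem1) :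
    FordGreenKonyaginTao2016_theorem1 :=
  fgkt2016_theorem1_of_rankinConstant (rankinConstant_of_fgkmt h)

/-- Consistency: the FGKMT covering bound (1.2) alone yields every typed gap theorem of the ladder —
here FGKT Theorem 1 and Maynard's Theorem 1. [folklore] -/
example (h : FordGreenKonyaginMaynardTao2018_coveringBound) :
    FordGreenKonyaginTao2016_theorem1 ∧ Maynard2016_theorem1 :=
  ⟨fgkt2016_theorem1_of_fgkmt2018_theorem1 (fgkmt2018_theorem1_of_coveringBound h),
    maynard2016_theorem1_of_fgkmt2018_theorem1 (fgkmt2018_theorem1_of_coveringBound h)⟩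

end Literature.NumberTheory.Sieve
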